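import Mathlib
import Literature.Combinatorics.Additive.TripleProductProperty
import Summits.MatrixMultiplication.MatrixMultiplication.Theorems.SnSubsetDichotomyNoThresholdSubsetTripleDefs
import Summits.MatrixMultiplication.MatrixMultiplication.Theorems.SnSubsetDichotomyNoThresholdSubsetTripleStubTransfer

/-!
# `SnSubsetDichotomy.NoThresholdSubsetTriple`, line `sidon-regime-hereditary-density` — stub
# `stub_spreadTransfer` (the transfer "`HDCount` + `C⁺_HD` ⇒ crux on the spread regime")

Registered stub `stub_spreadTransfer` of the skeleton
`Cruxes/NoThresholdSubsetTriple/Lines/sidon-regime-hereditary-density.lean` (crux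
`stmt-MatrixMultiplication-8302`), over the line's vocabulary file
`…Theorems/SnSubsetDichotomyNoThresholdSubsetTripleDefs.lean` (`diffSet`, `selfOverlap`,
`Spreadable`, and the two `Prop`-valued stub statements `HDCount`, `NoHDProductFreeTriple`, which
enter here only as HYPOTHESES).

Statement.  Assume the hereditary-density count `HDCount` and the target `C⁺_HD`
(`NoHDProductFreeTriple`).  Then for all `K' > 0`, `c > 0` there is `n₀` such that for `n ≥ n₀`
every triple `S, T, U ⊆ S_n` with the triple product property and three `K'`-spreadable sets has
`|S||T||U| ≤ (n!)^{3/2} e^{-c√n}`.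

Proof (all arithmetic at scale `e^{Θ(√n)}`).  Put `c₁ := c + 3K'`, `K := 2c₁ + K' + 1`, let `n₁`
be the threshold of `C⁺_HD` at `K` and `n₀ := max n₁ 1`.  For `n ≥ n₀` suppose
`vol := |S||T||U| > (n!)^{3/2} e^{-c√n}`.
* (i) `core_volume`: the spread cores `S₀ ⊆ S`, `T₀ ⊆ T`, `U₀ ⊆ U` (`|X| ≤ e^{K'√n}|X₀|`,
  `m(X₀) ≤ e^{K'√n}`) have `|S₀||T₀||U₀| > n!·√(n!)·e^{-c₁√n}`; hence they are non-empty and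
  `(S₀, T₀, U₀)` has the triple product property (`TripleProductProperty.mono`).
* (ii) `core_card_lower`: packing (`tpp_perm_card_mul_card_le_factorial`: `|S₀||T₀|`, `|T₀||U₀|`,
  `|U₀||S₀| ≤ n!`) gives `|X₀| > √(n!)·e^{-c₁√n}` for each core.
* (iii) `hd_of_core` (arithmetic in `hd_arith`): for a subgroup `H` with `|H| ≥ √(n!)e^{K√n}`,
  `HDCount` multiplied by `|H|` reads `|X₀|²|H| ≤ n!(|X₀| + m(X₀)|D_{X₀} ∩ H|)`
  (`[S_n : H]·|H| = n!`); since `|X₀||H| > n! e^{(K-c₁)√n} ≥ n! e^{√n} ≥ 2·n!` the diagonal term is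
  absorbed, `m(X₀)|D_{X₀} ∩ H| ≥ |X₀|²|H|/(2 n!) > e^{-2c₁√n}|H|/2`, and with `m(X₀) ≤ e^{K'√n}`,
  `e^{√n} ≥ 2`: `|D_{X₀} ∩ H| ≥ e^{-K√n}|H|`.
* (iv) The triple `(D_{S₀}, D_{T₀}, D_{U₀})` is symmetric (`inv_mem_diffSet`), misses `1`
  (`one_not_mem_diffSet`), is pairwise disjoint and product-free (`diffSets_of_tpp`) and
  hereditarily dense at rate `K` by (iii); `C⁺_HD` produces `d₁ d₂ d₃ = 1` — contradiction.
-/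

-- `Summit.<Summit>.<Problem>`: summit and problem coincide for this single-conjunct summit, so the
-- mandated namespace repeats a component.
set_option linter.dupNamespace false

noncomputable section

open scoped Classical
open Finset
open Literature.Combinatorics.Additive

namespace Summit.MatrixMultiplication.MatrixMultiplication.Theorems.NoThresholdSubsetTriple

/-! ### `Fin 3` bookkeeping -/

/-- A property holding for `a`, `b`, `c` holds for every entry of `![a, b, c]`. -/
theorem forall_fin_three {α : Type*} {P : α → Prop} {a b c : α} (ha : P a) (hb : P b)
    (hc : P c) : ∀ i : Fin 3, P (![a, b, c] i) := by
  intro i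
  fin_cases i
  exacts [ha, hb, hc]

/-- A relation holding for all six ordered pairs of distinct letters among `a`, `b`, `c` holds for
all pairs of entries of `![a, b, c]` with distinct indices. -/
theorem forall_fin_three_ne {α : Type*} {R : α → α → Prop} {a b c : α} (hab : R a b)
    (hac : R a c) (hba : R b a) (hbc : R b c) (hca : R c a) (hcb : R c b) :
    ∀ i j : Fin 3, i ≠ j → R (![a, b, c] i) (![a, b, c] j) := by
  intro i j hij
  fin_cases i <;> fin_cases j
  · exact absurd rfl hij
  · exact hab
  · exact hac
  · exact hba
  · exact absurd rfl hij
  · exact hbc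
  · exact hca
  · exact hcb
  · exact absurd rfl hij

/-! ### Real-analysis helpers -/

/-- `e^{√n} ≥ 2` for `n ≥ 1` (`e^x ≥ 1 + x`). -/
theorem two_le_exp_sqrt {n : ℕ} (hn : 1 ≤ n) : (2 : ℝ) ≤ Real.exp (Real.sqrt (n : ℝ)) := by
  have h1 : (1 : ℝ) ≤ Real.sqrt (n : ℝ) := by
    rw [Real.one_le_sqrt]
    exact_mod_cast hn
  linarith [Real.add_one_le_exp (Real.sqrt (n : ℝ))]

/-- `(n!)^{3/2} = n! · √(n!)` as real numbers. -/
theorem rpow_three_halves_factorial (n : ℕ) :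
    (n.factorial : ℝ) ^ ((3 : ℝ) / 2) = (n.factorial : ℝ) * Real.sqrt (n.factorial : ℝ) := by
  have hf : (0 : ℝ) ≤ (n.factorial : ℝ) := Nat.cast_nonneg _
  rw [Real.rpow_div_two_eq_sqrt _ hf, Real.rpow_ofNat, pow_succ, Real.sq_sqrt hf]

/-- `[S_n : H] · |H| = n!` for a subgroup `H ≤ S_n`, as real numbers. -/
theorem index_mul_natCard_perm {n : ℕ} (H : Subgroup (Equiv.Perm (Fin n))) :
    (H.index : ℝ) * (Nat.card H : ℝ) = (n.factorial : ℝ) := by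
  have h : H.index * Nat.card H = n.factorial := by
    rw [Subgroup.index_mul_card, Nat.card_perm, Nat.card_eq_fintype_card, Fintype.card_fin]
  exact_mod_cast h

/-- `HDCount` in `S_n`, multiplied through by `|H|`:
`|X|² · |H| ≤ n! · (|X| + m(X) · |D_X ∩ H|)`. -/
theorem hdCount_real (h1 : HDCount) {n : ℕ} (H : Subgroup (Equiv.Perm (Fin n)))
    (X : Finset (Equiv.Perm (Fin n))) :
    (X.card : ℝ) ^ 2 * (Nat.card H : ℝ) ≤
      (n.factorial : ℝ) * ((X.card : ℝ) +
        (selfOverlap X : ℝ) * (((diffSet X).filter (· ∈ H)).card : ℝ)) := by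
  have h := h1 (Equiv.Perm (Fin n)) H X
  have h' : (X.card : ℝ) ^ 2 ≤ (H.index : ℝ) * ((X.card : ℝ) +
      (selfOverlap X : ℝ) * (((diffSet X).filter (· ∈ H)).card : ℝ)) := by
    exact_mod_cast h
  calc (X.card : ℝ) ^ 2 * (Nat.card H : ℝ)
      ≤ (H.index : ℝ) * ((X.card : ℝ) +
          (selfOverlap X : ℝ) * (((diffSet X).filter (· ∈ H)).card : ℝ)) * (Nat.card H : ℝ) :=
        mul_le_mul_of_nonneg_right h' (Nat.cast_nonneg _)
    _ = (H.index : ℝ) * (Nat.card H : ℝ) * ((X.card : ℝ) +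
          (selfOverlap X : ℝ) * (((diffSet X).filter (· ∈ H)).card : ℝ)) := by ring
    _ = _ := by rw [index_mul_natCard_perm]

/-- The pure real arithmetic of step (iii).  With `s = √n` (`e^s ≥ 2`), `F = n!`, `x = |X₀|`,
`h = |H|`, `m = m(X₀)`, `d = |D_{X₀} ∩ H|`: if `x > √F e^{-c₁ s}`, `h ≥ √F e^{(2c₁+K'+1)s}`,
`m ≤ e^{K' s}` and `x² h ≤ F (x + m d)`, then `e^{-(2c₁+K'+1)s} h ≤ d`. -/
theorem hd_arith {s F x h m d c₁ K' : ℝ} (hs : 2 ≤ Real.exp s) (hs0 : 0 ≤ s) (hF : 0 < F)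
    (hc₁ : 0 ≤ c₁) (hK' : 0 ≤ K')
    (hx : Real.sqrt F * Real.exp (-(c₁ * s)) < x)
    (hH : Real.sqrt F * Real.exp ((2 * c₁ + K' + 1) * s) ≤ h)
    (hm : m ≤ Real.exp (K' * s)) (hd0 : 0 ≤ d)
    (h1 : x ^ 2 * h ≤ F * (x + m * d)) :
    Real.exp (-((2 * c₁ + K' + 1) * s)) * h ≤ d := by
  have hrF : 0 < Real.sqrt F := Real.sqrt_pos.2 hF
  have hx0 : 0 ≤ x := ((mul_pos hrF (Real.exp_pos _)).trans hx).le
  have hh0 : 0 < h := (mul_pos hrF (Real.exp_pos _)).trans_le hH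
  -- (a) `x h > F e^{(c₁+K'+1)s} ≥ F e^s ≥ 2F`
  have hxh : F * Real.exp ((c₁ + K' + 1) * s) < x * h := by
    calc F * Real.exp ((c₁ + K' + 1) * s)
        = Real.sqrt F * Real.exp (-(c₁ * s)) *
            (Real.sqrt F * Real.exp ((2 * c₁ + K' + 1) * s)) := by
          rw [mul_mul_mul_comm, Real.mul_self_sqrt hF.le, ← Real.exp_add]
          congr 1
          ring
      _ < x * h := mul_lt_mul hx hH (mul_pos hrF (Real.exp_pos _)) hx0
  have h2F : 2 * F ≤ x * h := by
    have h1s : Real.exp s ≤ Real.exp ((c₁ + K' + 1) * s) := by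
      rw [Real.exp_le_exp]
      nlinarith [mul_nonneg hc₁ hs0, mul_nonneg hK' hs0]
    calc 2 * F ≤ Real.exp s * F := mul_le_mul_of_nonneg_right hs hF.le
      _ ≤ Real.exp ((c₁ + K' + 1) * s) * F := mul_le_mul_of_nonneg_right h1s hF.le
      _ = F * Real.exp ((c₁ + K' + 1) * s) := mul_comm _ _
      _ ≤ x * h := hxh.le
  -- (b) the diagonal term is absorbed: `x² h ≤ 2 F m d ≤ 2 F e^{K's} d`
  have hFx : 2 * (F * x) ≤ x ^ 2 * h := by
    calc 2 * (F * x) = 2 * F * x := by ring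
      _ ≤ x * h * x := mul_le_mul_of_nonneg_right h2F hx0
      _ = x ^ 2 * h := by ring
  have hmd : F * (m * d) ≤ F * (Real.exp (K' * s) * d) :=
    mul_le_mul_of_nonneg_left (mul_le_mul_of_nonneg_right hm hd0) hF.le
  have hd2 : x ^ 2 * h ≤ 2 * F * (Real.exp (K' * s) * d) := by linarith
  -- (c) `x² > F e^{-2c₁ s}`
  have hx2 : F * Real.exp (-(2 * c₁ * s)) < x ^ 2 := by
    have h0 : 0 ≤ Real.sqrt F * Real.exp (-(c₁ * s)) := by positivity
    calc F * Real.exp (-(2 * c₁ * s)) = (Real.sqrt F * Real.exp (-(c₁ * s))) ^ 2 := by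
          rw [mul_pow, Real.sq_sqrt hF.le, sq (Real.exp _), ← Real.exp_add]
          congr 2
          ring
      _ < x ^ 2 := pow_lt_pow_left₀ hx h0 two_ne_zero
  -- (d) `2 F e^{K's} · e^{-Ks} h ≤ F e^{-2c₁ s} h < x² h ≤ 2 F e^{K's} d`
  have hE : Real.exp (K' * s) * Real.exp (-((2 * c₁ + K' + 1) * s)) =
      Real.exp (-(2 * c₁ * s)) * Real.exp (-s) := by
    rw [← Real.exp_add, ← Real.exp_add]
    congr 1
    ring
  have h2s : 2 * Real.exp (-s) ≤ 1 := by
    calc 2 * Real.exp (-s) ≤ Real.exp s * Real.exp (-s) :=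
          mul_le_mul_of_nonneg_right hs (Real.exp_pos _).le
      _ = 1 := by rw [← Real.exp_add, add_neg_cancel, Real.exp_zero]
  have key : 2 * F * Real.exp (K' * s) * (Real.exp (-((2 * c₁ + K' + 1) * s)) * h) <
      2 * F * Real.exp (K' * s) * d := by
    calc 2 * F * Real.exp (K' * s) * (Real.exp (-((2 * c₁ + K' + 1) * s)) * h)
        = F * (Real.exp (K' * s) * Real.exp (-((2 * c₁ + K' + 1) * s))) * h * 2 := by ring
      _ = F * Real.exp (-(2 * c₁ * s)) * h * (2 * Real.exp (-s)) := by rw [hE]; ring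
      _ ≤ F * Real.exp (-(2 * c₁ * s)) * h * 1 :=
          mul_le_mul_of_nonneg_left h2s (by positivity)
      _ = F * Real.exp (-(2 * c₁ * s)) * h := mul_one _
      _ < x ^ 2 * h := mul_lt_mul_of_pos_right hx2 hh0
      _ ≤ 2 * F * (Real.exp (K' * s) * d) := hd2
      _ = 2 * F * Real.exp (K' * s) * d := by ring
  exact (lt_of_mul_lt_mul_left key (by positivity)).le

/-! ### The four steps -/

/-- Step (i): the spread cores carry almost all the volume —
`|S||T||U| > (n!)^{3/2} e^{-c√n}` and `|X| ≤ e^{K'√n}|X₀|` give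
`|S₀||T₀||U₀| > n! · √(n!) · e^{-(c+3K')√n}`. -/
theorem core_volume {n : ℕ} {c K' : ℝ} {S T U S₀ T₀ U₀ : Finset (Equiv.Perm (Fin n))}
    (hvol : (n.factorial : ℝ) ^ ((3 : ℝ) / 2) * Real.exp (-(c * Real.sqrt (n : ℝ))) <
      ((S.card * T.card * U.card : ℕ) : ℝ))
    (hS : (S.card : ℝ) ≤ Real.exp (K' * Real.sqrt (n : ℝ)) * (S₀.card : ℝ))
    (hT : (T.card : ℝ) ≤ Real.exp (K' * Real.sqrt (n : ℝ)) * (T₀.card : ℝ))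
    (hU : (U.card : ℝ) ≤ Real.exp (K' * Real.sqrt (n : ℝ)) * (U₀.card : ℝ)) :
    (n.factorial : ℝ) *
        (Real.sqrt (n.factorial : ℝ) * Real.exp (-((c + 3 * K') * Real.sqrt (n : ℝ)))) <
      (S₀.card : ℝ) * (T₀.card : ℝ) * (U₀.card : ℝ) := by
  set s : ℝ := Real.sqrt (n : ℝ)
  have hE0 : 0 < Real.exp (K' * s) := Real.exp_pos _
  have h3 : ((S.card * T.card * U.card : ℕ) : ℝ) ≤
      Real.exp (K' * s) ^ 3 * ((S₀.card : ℝ) * (T₀.card : ℝ) * (U₀.card : ℝ)) := by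
    push_cast
    calc (S.card : ℝ) * (T.card : ℝ) * (U.card : ℝ)
        ≤ Real.exp (K' * s) * (S₀.card : ℝ) * (Real.exp (K' * s) * (T₀.card : ℝ)) *
            (Real.exp (K' * s) * (U₀.card : ℝ)) :=
          mul_le_mul (mul_le_mul hS hT (by positivity) (by positivity)) hU (by positivity)
            (by positivity)
      _ = Real.exp (K' * s) ^ 3 * ((S₀.card : ℝ) * (T₀.card : ℝ) * (U₀.card : ℝ)) := by ring
  have hexp : (n.factorial : ℝ) ^ ((3 : ℝ) / 2) * Real.exp (-(c * s)) =
      Real.exp (K' * s) ^ 3 * ((n.factorial : ℝ) *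
        (Real.sqrt (n.factorial : ℝ) * Real.exp (-((c + 3 * K') * s)))) := by
    have he : Real.exp (-(c * s)) = Real.exp (K' * s) ^ 3 * Real.exp (-((c + 3 * K') * s)) := by
      rw [pow_three, ← Real.exp_add, ← Real.exp_add, ← Real.exp_add]
      congr 1
      ring
    rw [rpow_three_halves_factorial, he]
    ring
  have h := hvol.trans_le h3
  rw [hexp] at h
  exact lt_of_mul_lt_mul_left h (pow_nonneg hE0.le 3)

/-- Step (ii): packing sizes a core from below — `F · L < x · y` and `y ≤ F` give `L < x`. -/
theorem core_card_lower {F L : ℝ} {x y : ℕ} (hF : 0 < F) (hvol : F * L < (x : ℝ) * (y : ℝ))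
    (hy : (y : ℝ) ≤ F) : L < x := by
  refine lt_of_mul_lt_mul_left ?_ hF.le
  calc F * L < (x : ℝ) * (y : ℝ) := hvol
    _ ≤ (x : ℝ) * F := mul_le_mul_of_nonneg_left hy (Nat.cast_nonneg _)
    _ = F * x := mul_comm _ _

/-- Step (iii): the difference set of a large spread core is hereditarily dense.  If
`m(X) ≤ e^{K'√n}` and `|X| > √(n!) e^{-c₁√n}` (`n ≥ 1`, `K', c₁ ≥ 0`), then for every subgroup
`H ≤ S_n` with `|H| ≥ √(n!) e^{(2c₁+K'+1)√n}` one has `|D_X ∩ H| ≥ e^{-(2c₁+K'+1)√n}|H|`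
(from `HDCount`). -/
theorem hd_of_core (h1 : HDCount) {n : ℕ} (hn : 1 ≤ n) {K' c₁ : ℝ} (hK' : 0 ≤ K')
    (hc₁ : 0 ≤ c₁) {X : Finset (Equiv.Perm (Fin n))}
    (hm : (selfOverlap X : ℝ) ≤ Real.exp (K' * Real.sqrt (n : ℝ)))
    (hx : Real.sqrt (n.factorial : ℝ) * Real.exp (-(c₁ * Real.sqrt (n : ℝ))) < (X.card : ℝ))
    (H : Subgroup (Equiv.Perm (Fin n)))
    (hH : Real.sqrt (n.factorial : ℝ) * Real.exp ((2 * c₁ + K' + 1) * Real.sqrt (n : ℝ)) ≤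
      (Nat.card H : ℝ)) :
    Real.exp (-((2 * c₁ + K' + 1) * Real.sqrt (n : ℝ))) * (Nat.card H : ℝ) ≤
      (((diffSet X).filter (· ∈ H)).card : ℝ) :=
  hd_arith (two_le_exp_sqrt hn) (Real.sqrt_nonneg _) (by exact_mod_cast Nat.factorial_pos n)
    hc₁ hK' hx hH hm (Nat.cast_nonneg _) (hdCount_real h1 H X)

/-! ### The stub -/

/-- **Stub `stub_spreadTransfer`** (line `sidon-regime-hereditary-density` of crux
`SnSubsetDichotomy.NoThresholdSubsetTriple`) — THE TRANSFER (Sidon-ification):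
`HDCount → C⁺_HD →` for all `K' > 0`, `c > 0` there is `n₀` beyond which every triple
`S, T, U ⊆ S_n` with the triple product property and three `K'`-spreadable sets satisfies
`|S||T||U| ≤ (n!)^{3/2} e^{-c√n}`.
Proof: with `c₁ := c + 3K'`, `K := 2c₁ + K' + 1`, `n₀ := max n₁(K) 1`, a counterexample has spread
cores `S₀, T₀, U₀` of volume `> n!√(n!)e^{-c₁√n}` (`core_volume`), which are non-empty, have the
triple product property (`TripleProductProperty.mono`) and sizes `> √(n!)e^{-c₁√n}` by packing
(`tpp_perm_card_mul_card_le_factorial`, `core_card_lower`); by `hd_of_core` their difference sets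
are hereditarily dense at rate `K`, and they are symmetric, miss `1`, pairwise disjoint and
product-free (`diffSets_of_tpp`) — contradicting `C⁺_HD` at `K`. -/
theorem stub_spreadTransfer :
    HDCount → NoHDProductFreeTriple → ∀ K' : ℝ, 0 < K' → ∀ c : ℝ, 0 < c → ∃ n₀ : ℕ, ∀ n ≥ n₀,
      ∀ S T U : Finset (Equiv.Perm (Fin n)), TripleProductProperty S T U →
        Spreadable K' n S → Spreadable K' n T → Spreadable K' n U →
          ((S.card * T.card * U.card : ℕ) : ℝ) ≤
            (n.factorial : ℝ) ^ ((3 : ℝ) / 2) * Real.exp (-(c * Real.sqrt (n : ℝ))) := by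
  intro h1 h2 K' hK' c hc
  have hc₁ : (0 : ℝ) ≤ c + 3 * K' := by positivity
  obtain ⟨n₁, hn₁⟩ := h2 (2 * (c + 3 * K') + K' + 1) (by positivity)
  refine ⟨max n₁ 1, fun n hn S T U hTPP hS hT hU => ?_⟩
  have hn₁n : n₁ ≤ n := le_of_max_le_left hn
  have hn1 : 1 ≤ n := le_of_max_le_right hn
  by_contra hlt
  rw [not_le] at hlt
  -- (i) the spread cores and their volume
  obtain ⟨S₀, hS₀S, hSle, hmS⟩ := hS
  obtain ⟨T₀, hT₀T, hTle, hmT⟩ := hT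
  obtain ⟨U₀, hU₀U, hUle, hmU⟩ := hU
  have hF : (0 : ℝ) < (n.factorial : ℝ) := by exact_mod_cast Nat.factorial_pos n
  have hvol₀ := core_volume hlt hSle hTle hUle
  have hpos : (0 : ℝ) < (S₀.card : ℝ) * (T₀.card : ℝ) * (U₀.card : ℝ) :=
    lt_of_le_of_lt (by positivity) hvol₀
  have hpos' : 0 < S₀.card * T₀.card * U₀.card := by exact_mod_cast hpos
  have hS₀0 : S₀.card ≠ 0 := fun h0 => by simp [h0] at hpos'
  have hT₀0 : T₀.card ≠ 0 := fun h0 => by simp [h0] at hpos'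
  have hU₀0 : U₀.card ≠ 0 := fun h0 => by simp [h0] at hpos'
  have hTPP₀ : TripleProductProperty S₀ T₀ U₀ := hTPP.mono hS₀S hT₀T hU₀U
  -- (ii) packing: each core is larger than `√(n!) e^{-c₁√n}`
  obtain ⟨hP1, hP2, hP3⟩ := tpp_perm_card_mul_card_le_factorial hTPP₀ hS₀0 hT₀0 hU₀0
  have hxS : Real.sqrt (n.factorial : ℝ) * Real.exp (-((c + 3 * K') * Real.sqrt (n : ℝ))) <
      (S₀.card : ℝ) :=
    core_card_lower hF (y := T₀.card * U₀.card) (by rw [Nat.cast_mul]; linarith [hvol₀])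
      (by exact_mod_cast hP2)
  have hxT : Real.sqrt (n.factorial : ℝ) * Real.exp (-((c + 3 * K') * Real.sqrt (n : ℝ))) <
      (T₀.card : ℝ) :=
    core_card_lower hF (y := U₀.card * S₀.card) (by rw [Nat.cast_mul]; linarith [hvol₀])
      (by exact_mod_cast hP3)
  have hxU : Real.sqrt (n.factorial : ℝ) * Real.exp (-((c + 3 * K') * Real.sqrt (n : ℝ))) <
      (U₀.card : ℝ) :=
    core_card_lower hF (y := S₀.card * T₀.card) (by rw [Nat.cast_mul]; linarith [hvol₀])
      (by exact_mod_cast hP1)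
  -- (iii)+(iv) `(D_{S₀}, D_{T₀}, D_{U₀})` is a symmetric, `1`-free, pairwise disjoint, HD triple,
  -- so `C⁺_HD` gives `d₁ d₂ d₃ = 1`, contradicting product-freeness (`diffSets_of_tpp`)
  obtain ⟨hdST, hdTU, hdUS, hpf⟩ := diffSets_of_tpp hTPP₀ (Finset.card_ne_zero.1 hS₀0)
    (Finset.card_ne_zero.1 hT₀0) (Finset.card_ne_zero.1 hU₀0)
  obtain ⟨d₁, hd₁, d₂, hd₂, d₃, hd₃, h123⟩ := hn₁ n hn₁n ![diffSet S₀, diffSet T₀, diffSet U₀]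
    (forall_fin_three (P := fun Y : Finset (Equiv.Perm (Fin n)) => ∀ d ∈ Y, d⁻¹ ∈ Y)
      (fun d hd => inv_mem_diffSet hd) (fun d hd => inv_mem_diffSet hd)
      (fun d hd => inv_mem_diffSet hd))
    (forall_fin_three (P := fun Y : Finset (Equiv.Perm (Fin n)) => (1 : Equiv.Perm (Fin n)) ∉ Y)
      (one_not_mem_diffSet S₀) (one_not_mem_diffSet T₀) (one_not_mem_diffSet U₀))
    (forall_fin_three_ne (R := fun Y Z : Finset (Equiv.Perm (Fin n)) => Disjoint Y Z)
      hdST hdUS.symm hdST.symm hdTU hdUS hdTU.symm)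
    (forall_fin_three
      (P := fun Y : Finset (Equiv.Perm (Fin n)) => ∀ H : Subgroup (Equiv.Perm (Fin n)),
        Real.sqrt (n.factorial : ℝ) *
            Real.exp ((2 * (c + 3 * K') + K' + 1) * Real.sqrt (n : ℝ)) ≤ (Nat.card H : ℝ) →
          Real.exp (-((2 * (c + 3 * K') + K' + 1) * Real.sqrt (n : ℝ))) * (Nat.card H : ℝ) ≤
            ((Y.filter (· ∈ H)).card : ℝ))
      (fun H hH => hd_of_core h1 hn1 hK'.le hc₁ hmS hxS H hH)
      (fun H hH => hd_of_core h1 hn1 hK'.le hc₁ hmT hxT H hH)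
      (fun H hH => hd_of_core h1 hn1 hK'.le hc₁ hmU hxU H hH))
  exact hpf d₁ hd₁ d₂ hd₂ d₃ hd₃ h123

end Summit.MatrixMultiplication.MatrixMultiplication.Theorems.NoThresholdSubsetTriple

end
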